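import Mathlib
import HarnessLib

/-!
# The exponential moment of a centred variable bounded above: `∫ e^{−G} dP ≥ 1 + Var(G)/(2 + M)` when `∫ G dP = 0` and `G ≤ M` — the variance form of the one-block floor

HONEST FRAMING: exact (Metropolis-corrected) sampling algorithms for lattice gauge theory;
figures of merit are autocorrelation/cost numbers at stated couplings and volumes; no
continuum-physics claim.

Venture `LatticeQCDFlow` (cell pub-lqcd), topic `Exactness`; FANOUT row 7 (`s0-cpn-null`).  NEW WORK
of the cell over Mathlib only; nothing is cited as a fact ([folklore] elementary inequality
`e^{−x} − 1 + x ≥ x²/(2 + M)` for `x ≤ M`, `M ≥ 0`).  Companion of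
`Exactness/CenteredExponentialMomentFloor.lean` (`∫e^{−G} ≥ 1 + (∫|G|)²/8`): here the one-block term
of the extensive entropy floor (`Exactness/LatticeBlockEntropyFloor.lean`) is bounded below by the
VARIANCE of the block's conditional log-weight, `log ∫e^{−(K − ∫K)} ≥ log(1 + Var(K)/(2 + M))` with
`M` an upper bound of `K − ∫K` — the currency in which coordinate averaging is monotone
(`Exactness/LatticeCoordAvgTower.lean`: `Var(A_{C'} G) ≤ Var(A_C G)`), so that a block term is bounded
below by the variance of ANY coarser conditional expectation of the block's log-weight.

## Content

* §1 `two_add_mul_exp_neg_sub_nonneg` — `0 ≤ (2 + x)e^{−x} − 2 + x` for `x ≥ 0` (its derivative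
  `1 − (1 + x)e^{−x}` is nonnegative); **`sq_div_le_exp_neg_sub_one_add`** — `x²/(2 + M) ≤ e^{−x} − 1 + x`
  for `x ≤ M`, `0 ≤ M`.
* §2 **`one_add_integral_sq_div_le_integral_exp_neg`** — `∫G = 0`, `G ≤ M` ⇒
  `1 + (∫G²)/(2 + M) ≤ ∫e^{−G}`; **`log_one_add_variance_div_le_log_integral_exp_neg_sub_mean`** — the
  centred packaging `log(1 + Var(G)/(2 + M)) ≤ log ∫e^{−(G − ∫G)}` for `G − ∫G ≤ M`.

NOT CLAIMED: two-sided (Gaussian) asymptotics; anything model-specific.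
-/

noncomputable section

namespace Summit.Ventures.LatticeQCDFlow.Exactness

open MeasureTheory Real Set

/-! ## §1 The pointwise inequality -/

section Pointwise

/-- `0 ≤ (2 + x)e^{−x} − 2 + x` for `0 ≤ x`: the function vanishes at `0` and has derivative
`1 − (1 + x)e^{−x} ≥ 0` (as `1 + x ≤ e^{x}`). -/
theorem two_add_mul_exp_neg_sub_nonneg {x : ℝ} (hx : 0 ≤ x) :
    0 ≤ (2 + x) * Real.exp (-x) - 2 + x := by
  let h : ℝ → ℝ := fun y => (2 + y) * Real.exp (-y) - 2 + y
  have hderiv : ∀ y, HasDerivAt h (1 - (1 + y) * Real.exp (-y)) y := by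
    intro y
    have h1 : HasDerivAt (fun y : ℝ => 2 + y) 1 y := by
      simpa using (hasDerivAt_id y).const_add 2
    have h2 : HasDerivAt (fun y : ℝ => Real.exp (-y)) (-Real.exp (-y)) y := by
      simpa using ((hasDerivAt_id y).neg).exp
    have h3 : HasDerivAt (fun y : ℝ => (2 + y) * Real.exp (-y) - 2 + y)
        (1 * Real.exp (-y) + (2 + y) * (-Real.exp (-y)) + 1) y :=
      ((h1.mul h2).sub_const 2).add (hasDerivAt_id' y)
    have e : 1 * Real.exp (-y) + (2 + y) * (-Real.exp (-y)) + 1 = 1 - (1 + y) * Real.exp (-y) := by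
      ring
    rw [e] at h3
    exact h3
  have hmono : MonotoneOn h (Ici 0) := by
    refine monotoneOn_of_deriv_nonneg (convex_Ici 0) ?_ ?_ ?_
    · exact (HasDerivAt.continuousOn fun y _ => hderiv y)
    · exact fun y _ => (hderiv y).differentiableAt.differentiableWithinAt
    · intro y hy
      rw [interior_Ici] at hy
      rw [(hderiv y).deriv]
      have hy0 : 0 ≤ y := le_of_lt hy
      have he : (1 + y) * Real.exp (-y) ≤ 1 := by
        have h1 : 1 + y ≤ Real.exp y := by linarith [Real.add_one_le_exp y]
        calc (1 + y) * Real.exp (-y) ≤ Real.exp y * Real.exp (-y) :=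
              mul_le_mul_of_nonneg_right h1 (Real.exp_pos _).le
          _ = 1 := by rw [← Real.exp_add, add_neg_cancel, Real.exp_zero]
      linarith
  have h0 : h 0 = 0 := by simp [h]
  have := hmono (self_mem_Ici : (0 : ℝ) ∈ Ici 0) (mem_Ici.2 hx) hx
  rw [h0] at this
  exact this

/-- **`x²/(2 + M) ≤ e^{−x} − 1 + x` for `x ≤ M`, `0 ≤ M`.**  For `x ≤ 0` the left side is at most
`x²/2 ≤ e^{−x} − 1 + x` (`e^{y} ≥ 1 + y + y²/2`, `y ≥ 0`); for `0 ≤ x ≤ M`,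
`(2 + M)(e^{−x} − 1 + x) ≥ (2 + x)(e^{−x} − 1 + x) = x² + ((2 + x)e^{−x} − 2 + x) ≥ x²`. -/
theorem sq_div_le_exp_neg_sub_one_add {x M : ℝ} (hM : 0 ≤ M) (hxM : x ≤ M) :
    x ^ 2 / (2 + M) ≤ Real.exp (-x) - 1 + x := by
  have h2M : 0 < 2 + M := by linarith
  rcases le_or_gt x 0 with hx | hx
  · have hq := Real.quadratic_le_exp_of_nonneg (x := -x) (by linarith)
    have h1 : x ^ 2 / (2 + M) ≤ x ^ 2 / 2 := by
      apply div_le_div_of_nonneg_left (sq_nonneg x) (by norm_num) (by linarith)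
    nlinarith
  · have hψ : 0 ≤ Real.exp (-x) - 1 + x := by linarith [Real.add_one_le_exp (-x)]
    have hh := two_add_mul_exp_neg_sub_nonneg hx.le
    rw [div_le_iff₀ h2M]
    have hexp : (2 + x) * (Real.exp (-x) - 1 + x) = x ^ 2 + ((2 + x) * Real.exp (-x) - 2 + x) := by ring
    calc x ^ 2 ≤ (2 + x) * (Real.exp (-x) - 1 + x) := by rw [hexp]; linarith
      _ ≤ (Real.exp (-x) - 1 + x) * (2 + M) := by
          rw [mul_comm]
          exact mul_le_mul_of_nonneg_left (by linarith) hψ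

end Pointwise

/-! ## §2 The variance floor on a probability space -/

section Floor

variable {Ω : Type*} [MeasurableSpace Ω] {P : Measure Ω} [IsProbabilityMeasure P]

/-- **`∫G dP = 0`, `G ≤ M` (`M ≥ 0`) ⇒ `1 + (∫G² dP)/(2 + M) ≤ ∫e^{−G} dP`** (integrable `G`, `G²`,
`e^{−G}`). -/
theorem one_add_integral_sq_div_le_integral_exp_neg {G : Ω → ℝ} (hG : Integrable G P)
    (hG2 : Integrable (fun ω => G ω ^ 2) P) (hexp : Integrable (fun ω => Real.exp (-G ω)) P)
    (h0 : ∫ ω, G ω ∂P = 0) {M : ℝ} (hM : 0 ≤ M) (hGM : ∀ ω, G ω ≤ M) :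
    1 + (∫ ω, G ω ^ 2 ∂P) / (2 + M) ≤ ∫ ω, Real.exp (-G ω) ∂P := by
  have hψ_int : Integrable (fun ω => Real.exp (-G ω) - 1 + G ω) P :=
    (hexp.sub (integrable_const 1)).add hG
  have hmono : ∫ ω, G ω ^ 2 / (2 + M) ∂P ≤ ∫ ω, (Real.exp (-G ω) - 1 + G ω) ∂P :=
    integral_mono (hG2.div_const _) hψ_int fun ω => sq_div_le_exp_neg_sub_one_add hM (hGM ω)
  have hsplit : ∫ ω, (Real.exp (-G ω) - 1 + G ω) ∂P = (∫ ω, Real.exp (-G ω) ∂P) - 1 := by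
    have hA : Integrable (fun ω => Real.exp (-G ω) - 1) P := hexp.sub (integrable_const 1)
    have h1 : Integrable (fun _ : Ω => (1 : ℝ)) P := integrable_const 1
    rw [integral_add hA hG, integral_sub hexp h1, integral_const, smul_eq_mul, probReal_univ, one_mul,
      h0, add_zero]
  rw [integral_div, hsplit] at hmono
  linarith

/-- **THE VARIANCE FORM OF THE ONE-BLOCK FLOOR: `log(1 + Var(G)/(2 + M)) ≤ log ∫ e^{−(G − ∫G)} dP`**
whenever `G − ∫G ≤ M` (`M ≥ 0`; integrable `G`, `G²`, `e^{−G}`). -/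
theorem log_one_add_variance_div_le_log_integral_exp_neg_sub_mean {G : Ω → ℝ} (hG : Integrable G P)
    (hG2 : Integrable (fun ω => G ω ^ 2) P) (hexp : Integrable (fun ω => Real.exp (-G ω)) P)
    {M : ℝ} (hM : 0 ≤ M) (hGM : ∀ ω, G ω - ∫ ω', G ω' ∂P ≤ M) :
    Real.log (1 + (∫ ω, (G ω - ∫ ω', G ω' ∂P) ^ 2 ∂P) / (2 + M)) ≤
      Real.log (∫ ω, Real.exp (-(G ω - ∫ ω', G ω' ∂P)) ∂P) := by
  set m : ℝ := ∫ ω', G ω' ∂P with hm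
  have hG' : Integrable (fun ω => G ω - m) P := hG.sub (integrable_const m)
  have hG2' : Integrable (fun ω => (G ω - m) ^ 2) P := by
    have hfun : (fun ω => (G ω - m) ^ 2) = fun ω => G ω ^ 2 - 2 * m * G ω + m ^ 2 := by
      funext ω; ring
    rw [hfun]
    exact (hG2.sub (hG.const_mul _)).add (integrable_const _)
  have hexp' : Integrable (fun ω => Real.exp (-(G ω - m))) P := by
    have hfun : (fun ω => Real.exp (-(G ω - m))) = fun ω => Real.exp m * Real.exp (-G ω) := by
      funext ω; rw [← Real.exp_add]; congr 1; ring
    rw [hfun]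
    exact hexp.const_mul _
  have h0 : ∫ ω, (G ω - m) ∂P = 0 := by
    rw [integral_sub hG (integrable_const m), integral_const, smul_eq_mul, probReal_univ, one_mul,
      hm, sub_self]
  have h := one_add_integral_sq_div_le_integral_exp_neg hG' hG2' hexp' h0 hM hGM
  have hpos : 0 < 1 + (∫ ω, (G ω - m) ^ 2 ∂P) / (2 + M) := by
    have : 0 ≤ (∫ ω, (G ω - m) ^ 2 ∂P) / (2 + M) :=
      div_nonneg (integral_nonneg fun ω => sq_nonneg _) (by linarith)
    linarith
  exact Real.log_le_log hpos h

end Floor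

end Summit.Ventures.LatticeQCDFlow.Exactness

end
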